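import Mathlib.Analysis.InnerProductSpace.Calculus
import Summits.FinalStateConjecture.FinalStateConjecture.Theorems.SoloBlindGenericity

/-!
# Solo (blind) — locality of tame codimension and the negation normal form of the summit

The genericity notion of the final state conjecture as typed
(`InitialDataSet.IsTameChristodoulouGeneric`, `InitialDataSet.HasTameCodimAtLeastIn` of
`Literature/Geometry/Lorentzian/TameGenericity.lean`) asks, through every exceptional datum `d`,
for a GLOBAL injective `m`-parameter family `F : ℝᵐ → InitialDataSet (𝓡 3) X` of admissible data,
tame on one end, immersed at `0`, with `F 0 = d` and `F c` non-exceptional for all `c ≠ 0`.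

We prove that this is a **germ condition at `d`**: it suffices that the family be injective,
admissible and non-exceptional on SOME parameter ball `B_δ(0)` (`soloBlind_hasTameCodimAtLeastIn_iff_local`).
The proof reparametrises by Mathlib's diffeomorphism `OpenPartialHomeomorph.univBall 0 δ : ℝᵐ ≅ B_δ(0)`,
which fixes `0`; tameness (`soloBlind_isTameDataFamily_comp`) and immersion at `0`
(`soloBlind_isImmersedAtZero_comp`, via injectivity of the differential of `univBall 0 δ` at `0`,
`soloBlind_injective_fderiv_univBall_zero`) are transported along it.

Consequence: the **negation normal form** of tame Christodoulou genericity
(`soloBlind_not_isTameChristodoulouGeneric_iff`) and of the summit itself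
(`soloBlind_not_statement_iff`): the final state conjecture FAILS iff some admissible `3`-manifold
`Σ` carries an admissible datum `d` that does not settle (`¬ SoloBlindSettles Σ d`) and is
**family-robustly exceptional** — every admissible `1`-parameter germ through `d`, tame on an end,
immersed at `0` and injective near `0`, contains non-settling members at parameters `c ≠ 0`
arbitrarily close to `0`. A refutation must therefore exhibit an exceptional phenomenon stable
along EVERY admissible perturbation curve, not merely one exceptional datum.

References: D. Christodoulou, *On the global initial value problem and the issue of
singularities*, CQG 16 (1999) A23–A35, p. A24; *The instability of naked singularities in the
gravitational collapse of a scalar field*, Ann. Math. 149 (1999) 183–217, p. 187 (codimension of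
the exceptional set via families `α₀ + c f`).
-/

noncomputable section

set_option linter.dupNamespace false

open Literature.Geometry.Lorentzian Set Metric Filter OpenPartialHomeomorph
open scoped Manifold ContDiff Topology

namespace Summit.FinalStateConjecture.FinalStateConjecture.Theorems

/-! ### Reparametrisation of families -/

section Reparametrisation

variable {E : Type*} [NormedAddCommGroup E] [NormedSpace ℝ E] {H : Type*} [TopologicalSpace H]
  {I : ModelWithCorners ℝ E H} {X : Type*} [TopologicalSpace X] [ChartedSpace H X]
  [IsManifold I ∞ X]

/-- Precomposition of a jointly smooth family with a smooth map of the parameter space is a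
jointly smooth family. [folklore] -/
theorem soloBlind_isSmoothDataFamily_comp {m : ℕ}
    {F : EuclideanSpace ℝ (Fin m) → InitialDataSet I X} (hF : InitialDataSet.IsSmoothDataFamily m F)
    {φ : EuclideanSpace ℝ (Fin m) → EuclideanSpace ℝ (Fin m)} (hφ : ContDiff ℝ ∞ φ) :
    InitialDataSet.IsSmoothDataFamily m (F ∘ φ) := by
  have hΨ : ContMDiff (𝓘(ℝ, EuclideanSpace ℝ (Fin m)).prod I) (𝓘(ℝ, EuclideanSpace ℝ (Fin m)).prod I)
      ∞ (fun p : EuclideanSpace ℝ (Fin m) × X ↦ (φ p.1, p.2)) :=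
    (hφ.contMDiff.comp contMDiff_fst).prodMk contMDiff_snd
  exact ⟨hF.1.comp hΨ, hF.2.comp hΨ⟩

/-- Chain rule at `0` for a scalar component: if `fderiv s 0 (dφ(0) v) ≠ 0` then the
`v`-derivative at `0` of `s ∘ φ` is non-zero (`φ 0 = 0`, `φ` differentiable at `0`). [folklore] -/
theorem soloBlind_fderiv_comp_apply_ne_zero {m : ℕ}
    {φ : EuclideanSpace ℝ (Fin m) → EuclideanSpace ℝ (Fin m)} (hφ0 : φ 0 = 0)
    (hφd : DifferentiableAt ℝ φ 0) {s : EuclideanSpace ℝ (Fin m) → ℝ} {v : EuclideanSpace ℝ (Fin m)}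
    (h : fderiv ℝ s 0 (fderiv ℝ φ 0 v) ≠ 0) : fderiv ℝ (fun c ↦ s (φ c)) 0 v ≠ 0 := by
  have hs : DifferentiableAt ℝ s (φ 0) := by
    rw [hφ0]
    by_contra hs
    apply h
    simp [fderiv_zero_of_not_differentiableAt hs]
  rw [fderiv_fun_comp 0 hs hφd, ContinuousLinearMap.comp_apply, hφ0]
  exact h

/-- Immersion at `0` is transported along a reparametrisation fixing `0` with injective
differential at `0`. [folklore] -/
theorem soloBlind_isImmersedAtZero_comp {m : ℕ}
    {F : EuclideanSpace ℝ (Fin m) → InitialDataSet I X} (hF : InitialDataSet.IsImmersedAtZero m F)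
    {φ : EuclideanSpace ℝ (Fin m) → EuclideanSpace ℝ (Fin m)} (hφ0 : φ 0 = 0)
    (hφd : DifferentiableAt ℝ φ 0) (hinj : Function.Injective (fderiv ℝ φ 0)) :
    InitialDataSet.IsImmersedAtZero m (F ∘ φ) := by
  intro v hv
  have hv' : fderiv ℝ φ 0 v ≠ 0 := fun h ↦ hv (hinj (h.trans (map_zero _).symm))
  obtain ⟨x, u, w, h⟩ := hF _ hv'
  exact ⟨x, u, w, h.imp
    (soloBlind_fderiv_comp_apply_ne_zero (s := fun c ↦ (F c).h.inner x u w) hφ0 hφd)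
    (soloBlind_fderiv_comp_apply_ne_zero (s := fun c ↦ (F c).k x u w) hφ0 hφd)⟩

/-- The differential at `0` of Mathlib's diffeomorphism `univBall 0 r : F ≅ B_r(0)` (`r > 0`) is
injective: it has the left inverse `d(univBall 0 r).symm (0)`. [folklore] -/
theorem soloBlind_injective_fderiv_univBall_zero {F : Type*} [NormedAddCommGroup F]
    [InnerProductSpace ℝ F] {r : ℝ} (hr : 0 < r) :
    Function.Injective (fderiv ℝ (univBall (0 : F) r) 0) := by
  have hφd : DifferentiableAt ℝ (univBall (0 : F) r) 0 :=
    ((contDiff_univBall (n := 1)).differentiable one_ne_zero).differentiableAt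
  have hψd : DifferentiableAt ℝ (univBall (0 : F) r).symm (univBall (0 : F) r 0) := by
    rw [univBall_apply_zero]
    exact ((contDiffOn_univBall_symm (n := 1)).differentiableOn one_ne_zero).differentiableAt
      (isOpen_ball.mem_nhds (mem_ball_self hr))
  have hcomp : (fderiv ℝ (univBall (0 : F) r).symm (univBall (0 : F) r 0)).comp
      (fderiv ℝ (univBall (0 : F) r) 0) = ContinuousLinearMap.id ℝ F := by
    rw [← fderiv_comp 0 hψd hφd]
    have : ((univBall (0 : F) r).symm ∘ (univBall (0 : F) r) : F → F) = id :=
      funext fun x ↦ (univBall (0 : F) r).left_inv (by simp)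
    rw [this, fderiv_id]
  refine Function.LeftInverse.injective
    (g := fderiv ℝ (univBall (0 : F) r).symm (univBall (0 : F) r 0)) fun v ↦ ?_
  simpa using DFunLike.congr_fun hcomp v

end Reparametrisation

/-! ### Locality of tame codimension -/

section Locality

variable {X : Type*} [TopologicalSpace X] [ChartedSpace E3 X] [IsManifold (𝓡 3) ∞ X]

/-- Tameness on an end is transported along a smooth reparametrisation fixing `0` (joint
smoothness, the continuous mass function and the weighted continuity at the base parameter all
compose). [folklore] -/
theorem soloBlind_isTameDataFamily_comp {e : AFEnd X} {m : ℕ}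
    {F : EuclideanSpace ℝ (Fin m) → InitialDataSet (𝓡 3) X}
    (hF : InitialDataSet.IsTameDataFamily e m F)
    {φ : EuclideanSpace ℝ (Fin m) → EuclideanSpace ℝ (Fin m)} (hφ : ContDiff ℝ ∞ φ)
    (hφ0 : φ 0 = 0) : InitialDataSet.IsTameDataFamily e m (F ∘ φ) := by
  obtain ⟨hs, he, ⟨M, hM, hMF⟩, hT⟩ := hF
  refine ⟨soloBlind_isSmoothDataFamily_comp hs hφ, he, ⟨M ∘ φ, hM.comp hφ.continuous,
    fun c ↦ hMF (φ c)⟩, ?_⟩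
  have hφc : Tendsto φ (𝓝 0) (𝓝 0) := by simpa only [hφ0] using hφ.continuous.tendsto 0
  simpa only [Function.comp_def, hφ0] using hT.comp hφc

/-- **Locality of tame codimension (germ ⇒ global).** If through every `d ∈ 𝓔` there is a family,
tame on an end and immersed at `0`, with `F 0 = d`, which on SOME parameter ball `B_δ(0)` is
injective, admissible and meets `𝓔` only at `0`, then `𝓔` has tame codimension `≥ m` inside `𝓓`:
reparametrise by `univBall 0 δ : ℝᵐ ≅ B_δ(0)`. [folklore] -/
theorem soloBlind_hasTameCodimAtLeastIn_of_local {𝓓 𝓔 : Set (InitialDataSet (𝓡 3) X)} {m : ℕ}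
    (h : ∀ d ∈ 𝓔, ∃ (e : AFEnd X) (F : EuclideanSpace ℝ (Fin m) → InitialDataSet (𝓡 3) X),
      InitialDataSet.IsTameDataFamily e m F ∧ InitialDataSet.IsImmersedAtZero m F ∧ F 0 = d ∧
        ∃ δ > 0, InjOn F (ball 0 δ) ∧ (∀ c ∈ ball (0 : EuclideanSpace ℝ (Fin m)) δ, F c ∈ 𝓓) ∧
          ∀ c ∈ ball (0 : EuclideanSpace ℝ (Fin m)) δ, c ≠ 0 → F c ∉ 𝓔) :
    InitialDataSet.HasTameCodimAtLeastIn 𝓓 𝓔 m := by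
  intro d hd
  obtain ⟨e, F, hF, hI, h0, δ, hδ, hinj, hD, hE⟩ := h d hd
  have hφ0 : univBall (0 : EuclideanSpace ℝ (Fin m)) δ 0 = 0 := univBall_apply_zero 0 δ
  have hφs : ContDiff ℝ ∞ (univBall (0 : EuclideanSpace ℝ (Fin m)) δ) := contDiff_univBall
  have hφball : ∀ c, univBall (0 : EuclideanSpace ℝ (Fin m)) δ c ∈ ball 0 δ := fun c ↦ by
    rw [← univBall_target 0 hδ]
    exact (univBall (0 : EuclideanSpace ℝ (Fin m)) δ).map_source (by simp)
  have hφinj : Function.Injective (univBall (0 : EuclideanSpace ℝ (Fin m)) δ) := by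
    have := (univBall (0 : EuclideanSpace ℝ (Fin m)) δ).injOn
    rwa [univBall_source, injOn_univ] at this
  refine ⟨e, F ∘ univBall (0 : EuclideanSpace ℝ (Fin m)) δ,
    soloBlind_isTameDataFamily_comp hF hφs hφ0,
    soloBlind_isImmersedAtZero_comp hI hφ0 ((hφs.differentiable (by simp)).differentiableAt)
      (soloBlind_injective_fderiv_univBall_zero hδ),
    by simp [hφ0, h0], fun a b hab ↦ hφinj (hinj (hφball a) (hφball b) hab),
    fun c ↦ hD _ (hφball c), fun c hc ↦ hE _ (hφball c) fun h' ↦ hc (hφinj (h'.trans hφ0.symm))⟩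

/-- **Tame codimension is a germ condition** at each exceptional datum. [folklore] -/
theorem soloBlind_hasTameCodimAtLeastIn_iff_local {𝓓 𝓔 : Set (InitialDataSet (𝓡 3) X)} {m : ℕ} :
    InitialDataSet.HasTameCodimAtLeastIn 𝓓 𝓔 m ↔
      ∀ d ∈ 𝓔, ∃ (e : AFEnd X) (F : EuclideanSpace ℝ (Fin m) → InitialDataSet (𝓡 3) X),
        InitialDataSet.IsTameDataFamily e m F ∧ InitialDataSet.IsImmersedAtZero m F ∧ F 0 = d ∧
          ∃ δ > 0, InjOn F (ball 0 δ) ∧ (∀ c ∈ ball (0 : EuclideanSpace ℝ (Fin m)) δ, F c ∈ 𝓓) ∧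
            ∀ c ∈ ball (0 : EuclideanSpace ℝ (Fin m)) δ, c ≠ 0 → F c ∉ 𝓔 := by
  refine ⟨fun h d hd ↦ ?_, soloBlind_hasTameCodimAtLeastIn_of_local⟩
  obtain ⟨e, F, hF, hI, h0, hinj, hD, hE⟩ := h d hd
  exact ⟨e, F, hF, hI, h0, 1, one_pos, fun a _ b _ hab ↦ hinj hab, fun c _ ↦ hD c,
    fun c _ hc ↦ hE c hc⟩

/-- **Negation normal form of tame Christodoulou genericity.** `P` FAILS to be tame-generic with
codimension `m` inside `𝓓` iff some admissible exceptional datum `d` is family-robustly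
exceptional: every admissible family germ through `d`, tame on an end, immersed at `0` and
injective near `0`, has exceptional members at parameters `≠ 0` in every ball. [folklore] -/
theorem soloBlind_not_isTameChristodoulouGeneric_iff {𝓓 : Set (InitialDataSet (𝓡 3) X)}
    {P : InitialDataSet (𝓡 3) X → Prop} {m : ℕ} :
    ¬ InitialDataSet.IsTameChristodoulouGeneric 𝓓 P m ↔
      ∃ d ∈ 𝓓, ¬ P d ∧
        ∀ (e : AFEnd X) (F : EuclideanSpace ℝ (Fin m) → InitialDataSet (𝓡 3) X),
          InitialDataSet.IsTameDataFamily e m F → InitialDataSet.IsImmersedAtZero m F → F 0 = d →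
            ∀ δ > 0, InjOn F (ball 0 δ) → (∀ c ∈ ball (0 : EuclideanSpace ℝ (Fin m)) δ, F c ∈ 𝓓) →
              ∃ c ∈ ball (0 : EuclideanSpace ℝ (Fin m)) δ, c ≠ 0 ∧ ¬ P (F c) := by
  rw [InitialDataSet.IsTameChristodoulouGeneric, soloBlind_hasTameCodimAtLeastIn_iff_local]
  push Not
  simp only [mem_setOf_eq]
  constructor
  · rintro ⟨d, ⟨hd𝓓, hdP⟩, h⟩
    refine ⟨d, hd𝓓, hdP, fun e F hF hI h0 δ hδ hinj hD ↦ ?_⟩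
    obtain ⟨c, hc, hc0, -, hcP⟩ := h e F hF hI h0 δ hδ hinj hD
    exact ⟨c, hc, hc0, hcP⟩
  · rintro ⟨d, hd𝓓, hdP, h⟩
    refine ⟨d, ⟨hd𝓓, hdP⟩, fun e F hF hI h0 δ hδ hinj hD ↦ ?_⟩
    obtain ⟨c, hc, hc0, hcP⟩ := h e F hF hI h0 δ hδ hinj hD
    exact ⟨c, hc, hc0, hD c hc, hcP⟩

end Locality

/-! ### The negation normal form of the summit -/

/-- **What a refutation of the final state conjecture must exhibit.** The summit fails iff some
admissible `Σ` carries an admissible vacuum datum `d` which does not settle and such that EVERY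
admissible `1`-parameter germ through `d` — tame on an asymptotically flat end, immersed at `0`,
injective near `0` — contains non-settling data at parameters `c ≠ 0` arbitrarily close to `0`.
[folklore] -/
theorem soloBlind_not_statement_iff :
    ¬ FinalStateConjecture ↔
      ∃ (X : Type) (_ : TopologicalSpace X) (_ : ChartedSpace E3 X) (_ : IsManifold (𝓡 3) ∞ X)
        (_ : T2Space X) (_ : SecondCountableTopology X) (_ : ConnectedSpace X),
        ∃ d ∈ admissibleVacuumData X, ¬ SoloBlindSettles X d ∧
          ∀ (e : AFEnd X) (F : EuclideanSpace ℝ (Fin 1) → InitialDataSet (𝓡 3) X),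
            InitialDataSet.IsTameDataFamily e 1 F → InitialDataSet.IsImmersedAtZero 1 F → F 0 = d →
              ∀ δ > 0, InjOn F (ball 0 δ) →
                (∀ c ∈ ball (0 : EuclideanSpace ℝ (Fin 1)) δ, F c ∈ admissibleVacuumData X) →
                  ∃ c ∈ ball (0 : EuclideanSpace ℝ (Fin 1)) δ, c ≠ 0 ∧ ¬ SoloBlindSettles X (F c) := by
  rw [soloBlind_statement_iff]
  push Not
  simp only [soloBlind_not_isTameChristodoulouGeneric_iff]

end Summit.FinalStateConjecture.FinalStateConjecture.Theorems

end
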